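import Mathlib
import HarnessLib
import Summits.NavierStokesRegularity.NavierStokesRegularity.Theorems.PoloidalWindowDoorPoloidalWindowRigidityLargeScaleEnergy

/-!
# Route `PoloidalWindowDoor`, crux `PoloidalWindowRigidity` (K2, stmt-NavierStokesRegularity-19708) —
# large-scale MEAN energy of a Type-I profile tends to zero (corollary of `…LargeScaleEnergy`)

Cell ns-regularity-ideate, seat ns-poloidal-K2-p1 (K2 lead, gen 2; `--supports stmt-…-19708 --as helper`).  Under the BMO-type
pressure hypothesis `hBMO` of `…LargeScaleEnergy.exists_largeScale_energy_bound`, the mean kinetic energy of every slice of a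
profile of the route's Type-I class over the balls `B̄_R(0)` tends to `0` as `R → ∞`.  Stratum currency: a profile one slice of
which keeps mean energy `≥ ε` on balls `B̄_{R_j}`, `R_j → ∞` — e.g. a nonzero spatially periodic or Bohr-almost-periodic slice, or a
slice with `|v| ≥ ε` on a set of positive upper density — does not exist in the class (given `hBMO`).

WHAT THIS IS NOT: not a claim about Navier–Stokes regularity and not the open residue — a conditional corollary (bears_on LADDER-NS N0).
-/

noncomputable section

-- the summit and its single sub-problem share the name (CONVENTIONS §1), as in every Theorems file
set_option linter.dupNamespace false

namespace Summit.NavierStokesRegularity.NavierStokesRegularity.Theorems.PoloidalWindowDoorPoloidalWindowRigidityLargeScaleEnergyLimit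

open MeasureTheory Set Function Filter Topology Metric
open scoped RealInnerProductSpace
open Literature.Analysis Literature.Analysis.FluidPDE
open Summit.NavierStokesRegularity.NavierStokesRegularity.Theorems.PoloidalWindowDoorPoloidalWindowRigidityLargeScaleEnergy

variable {C : ℝ} {v : ℝ → (EuclideanSpace ℝ (Fin 3)) → (EuclideanSpace ℝ (Fin 3))}

/-- **Stratum currency.** Under `hBMO`, a profile of the class one slice of which keeps mean energy `≥ ε|B̄_R|` on a
sequence of balls `B̄_{R_j}(0)`, `R_j → ∞` (`ε > 0`) — e.g. a spatially periodic or Bohr-almost-periodic nonzero slice —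
does not exist: the large-scale mean energy tends to zero. -/
theorem largeScale_meanEnergy_tendsto_zero (hrate : HasTypeITimeDecay C v)
    (hcont : ContinuousOn (uncurry v) (Iio (0 : ℝ) ×ˢ univ))
    (hmild : ∀ s t : ℝ, s < t → t < 0 → ∀ x,
      v t x = UnboundedOperators.heatExtension (v s) (t - s) x - oseenDuhamel 1 s v v t x)
    (hdiv : ∀ t < 0, VectorCalculus.IsDivFree (v t)) {A : ℝ} (hA : 0 ≤ A)
    (hBMO : ∀ t₀ < 0, ∀ p : ℝ → (EuclideanSpace ℝ (Fin 3)) → ℝ, IsClassicalNSSolutionOn (Ioo t₀ 0) 1 0 v p →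
      ∀ s, t₀ < s → s < 0 → ∀ R : ℝ, 0 < R → ∃ c : ℝ,
        ∫ x in closedBall (0 : (EuclideanSpace ℝ (Fin 3))) R, |p s x - c| ≤ A / (-s) * (volume (closedBall (0 : (EuclideanSpace ℝ (Fin 3))) R)).toReal)
    {t : ℝ} (ht : t < 0) :
    Tendsto (fun R : ℝ => (∫ x in closedBall (0 : (EuclideanSpace ℝ (Fin 3))) R, ‖v t x‖ ^ 2) / (volume (closedBall (0 : (EuclideanSpace ℝ (Fin 3))) R)).toReal)
      atTop (nhds 0) := by
  obtain ⟨K, hK0, hK⟩ := exists_largeScale_energy_bound hrate hcont hmild hdiv hA hBMO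
  set M : ℝ := K * (1 / (-t) + 1 + 1 / Real.sqrt (-t)) with hM
  have hM0 : 0 ≤ M := by have : 0 < -t := neg_pos.2 ht; positivity
  -- `0 ≤ ratio ≤ M / R` for `R ≥ 1`
  have hup : ∀ᶠ R : ℝ in atTop, (∫ x in closedBall (0 : (EuclideanSpace ℝ (Fin 3))) R, ‖v t x‖ ^ 2) /
      (volume (closedBall (0 : (EuclideanSpace ℝ (Fin 3))) R)).toReal ≤ M / R := by
    filter_upwards [eventually_ge_atTop (1 : ℝ)] with R hR
    have hR0 : 0 < R := by linarith
    have hvol : 0 < (volume (closedBall (0 : (EuclideanSpace ℝ (Fin 3))) R)).toReal :=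
      ENNReal.toReal_pos (measure_closedBall_pos volume _ hR0).ne' measure_closedBall_lt_top.ne
    rw [div_le_iff₀ hvol]
    have h := hK t ht R hR
    calc ∫ x in closedBall (0 : (EuclideanSpace ℝ (Fin 3))) R, ‖v t x‖ ^ 2
        ≤ K * ((1 / (-t) + 1 + 1 / Real.sqrt (-t)) / R) * (volume (closedBall (0 : (EuclideanSpace ℝ (Fin 3))) R)).toReal := h
      _ = M / R * (volume (closedBall (0 : (EuclideanSpace ℝ (Fin 3))) R)).toReal := by rw [hM]; ring
  have hlow : ∀ᶠ R : ℝ in atTop, 0 ≤ (∫ x in closedBall (0 : (EuclideanSpace ℝ (Fin 3))) R, ‖v t x‖ ^ 2) /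
      (volume (closedBall (0 : (EuclideanSpace ℝ (Fin 3))) R)).toReal :=
    Eventually.of_forall fun R => div_nonneg (integral_nonneg fun x => sq_nonneg _) ENNReal.toReal_nonneg
  have hlim : Tendsto (fun R : ℝ => M / R) atTop (nhds 0) := tendsto_const_nhds.div_atTop tendsto_id
  exact tendsto_of_tendsto_of_tendsto_of_le_of_le' tendsto_const_nhds hlim hlow hup

end Summit.NavierStokesRegularity.NavierStokesRegularity.Theorems.PoloidalWindowDoorPoloidalWindowRigidityLargeScaleEnergyLimit
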